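import Summits.AtomisticToContinuum.BoseEinsteinCondensation.Theses.BECStronglyRayleigh
import Summits.AtomisticToContinuum.BoseEinsteinCondensation.Theorems.LatticeToPeriodicBridge.Negative.WindowedBridge
import Literature.Barriers.AtomisticToContinuum.KineticGapLengthScalesScaling
import Literature.MathematicalPhysics.QuantumManyBody.JelliumBoseGasDilation

/-!
# Negative lemmas for crux `LatticeToPeriodicBridge` (stmt-AtomisticToContinuum-9674), IV:
# dilation covariance of the consequent — thresholds scale like `R₀⁻³`, and the bridge reduces
# to potentials of unit range

Supports stmt-AtomisticToContinuum-9674 (route `BECStronglyRayleigh`, rank 4). Structural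
book-keeping behind part II (`Negative/UniformThreshold.lean`: the density threshold `ρ₀(v)` of
the consequent is genuinely `v`-dependent, `ρ₀(hardCorePotential a) ≤ 8/a³`):

* `consequentBody_scaledPotential` — EXACT dilation covariance of the consequent's body
  (`ConsequentAt` of part I with the threshold exposed): if it holds for `v` below `ρ₀`, it holds for
  LSSY's scaled potential `b⁻²v(·/b)` (`scaledPotential v b`, range `bR₀`, scattering length `b·a`)
  below `ρ₀/b³`, with the same constant `c` and slack `b⁻²δ` (from the tree's dilation API
  `iInf_condensateOccupation_scaledPotential_le`, `sideLength_div_pow_three`);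
  `consequentAt_scaledPotential_iff`.
* `periodicBEC_iff_unitRange` — hence stmt-0826's `PeriodicBEC` is equivalent to its restriction
  to admissible potentials vanishing beyond radius `1`, and `crux_iff_unitRange` — so is the crux:
  `LatticeToPeriodicBridge ↔ (KineticLatticeBEC → ∀ v adm., (∀ r > 1, v r = 0) → ConsequentAt v)`.
  One parameter (the range) is thereby normalised away for any prover of the bridge; conversely a
  refuter's bad potential may be sought among unit-range ones.

No `def`; the only route statements mentioned appear inside `↔`. `[folklore]` (LSSY 2005, Ch. 5,
footnote to (5.3): "By scaling, this is mathematically equivalent to fixing the interaction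
potential").
-/

noncomputable section

namespace Summit.AtomisticToContinuum.BoseEinsteinCondensation.Theorems.LatticeToPeriodicBridge.Negative

open Literature.MathematicalPhysics.QuantumManyBody.BoseGas
open Literature.Barriers.AtomisticToContinuum.BoseGas
open Literature.MathematicalPhysics.QuantumManyBody.JelliumBoseGas (sideLength_div_pow_three)
open _root_.MeasureTheory _root_.Filter _root_.Topology
open scoped ENNReal NNReal

open Summit.AtomisticToContinuum.BoseEinsteinCondensation.Theses
open Summit.AtomisticToContinuum.BoseEinsteinCondensation.Theses.BECStronglyRayleigh

/-- **Dilation covariance of the consequent's body.** If every `δ`-near-minimiser of `v` condenses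
(`≥ cN`) at all densities below `ρ₀`, then every near-minimiser of `b⁻²v(·/b)` condenses, with the
same `c`, at all densities below `ρ₀/b³`. [folklore] -/
theorem consequentBody_scaledPotential {v : ℝ → ℝ≥0∞} {b ρ₀ : ℝ} (hb : 0 < b)
    (h : ∀ ρ : ℝ, 0 < ρ → ρ < ρ₀ → ∃ c : ℝ, 0 < c ∧ ∀ᶠ N : ℕ in atTop,
      ∃ δ : ℝ≥0∞, 0 < δ ∧ ∀ Ψ : PeriodicTrialState N (sideLength ρ N),
        periodicEnergy v Ψ ≤ periodicGroundStateEnergy v N (sideLength ρ N) + δ →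
          ENNReal.ofReal (c * N) ≤ condensateOccupation N (sideLength ρ N) Ψ.ψ) :
    ∀ ρ : ℝ, 0 < ρ → ρ < ρ₀ / b ^ 3 → ∃ c : ℝ, 0 < c ∧ ∀ᶠ N : ℕ in atTop,
      ∃ δ : ℝ≥0∞, 0 < δ ∧ ∀ Ψ : PeriodicTrialState N (sideLength ρ N),
        periodicEnergy (scaledPotential v b) Ψ ≤
            periodicGroundStateEnergy (scaledPotential v b) N (sideLength ρ N) + δ →
          ENNReal.ofReal (c * N) ≤ condensateOccupation N (sideLength ρ N) Ψ.ψ := by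
  intro ρ hρ hρlt
  have hb3 : 0 < b ^ 3 := by positivity
  -- the un-scaled density `ρ₁ = ρ b³ < ρ₀`
  have hρ₁ : 0 < ρ * b ^ 3 := by positivity
  have hρ₁lt : ρ * b ^ 3 < ρ₀ := by rwa [lt_div_iff₀ hb3] at hρlt
  obtain ⟨c, hc, hev⟩ := h (ρ * b ^ 3) hρ₁ hρ₁lt
  refine ⟨c, hc, ?_⟩
  filter_upwards [hev, eventually_gt_atTop 0] with N hN hNpos
  obtain ⟨δ₁, hδ₁, hΦ⟩ := hN
  have hb2 : ENNReal.ofReal (b⁻¹ ^ 2) ≠ 0 := by simpa using hb.ne'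
  refine ⟨ENNReal.ofReal (b⁻¹ ^ 2) * δ₁, ENNReal.mul_pos hb2 hδ₁.ne', fun Ψ hΨ => ?_⟩
  -- side lengths: `L(ρ) = b · L(ρ b³)`
  set L := sideLength (ρ * b ^ 3) N with hLdef
  have hLpos : 0 < L := sideLength_pos_of_pos hρ₁ hNpos
  have hL' : sideLength ρ N = b * L := by
    rw [hLdef, ← sideLength_div_pow_three hρ₁ hb N, mul_div_assoc, div_self hb3.ne', mul_one]
  have hL'pos : 0 < sideLength ρ N := sideLength_pos_of_pos hρ hNpos
  -- dilate the near-minimisers of the scaled problem back by `b⁻¹`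
  have hM : L = b⁻¹ * sideLength ρ N := by rw [hL', inv_mul_cancel_left₀ hb.ne']
  have key := iInf_condensateOccupation_scaledPotential_le (inv_pos.2 hb) hM hL'pos
    (scaledPotential v b) N δ₁
  rw [scaledPotential_scaledPotential_inv hb] at key
  -- the un-scaled infimum is `≥ cN` by hypothesis
  have hinf : ENNReal.ofReal (c * N) ≤
      ⨅ (Φ : PeriodicTrialState N L) (_ : periodicEnergy v Φ ≤
        periodicGroundStateEnergy v N L + δ₁), condensateOccupation N L Φ.ψ :=
    le_iInf₂ fun Φ hΦE => hΦ Φ hΦE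
  exact (hinf.trans key).trans (iInf₂_le Ψ hΨ)

/-- The same with the thresholds packaged: `ConsequentAt v → ConsequentAt (b⁻²v(·/b))`.
[folklore] -/
theorem consequentAt_scaledPotential {v : ℝ → ℝ≥0∞} {b : ℝ} (hb : 0 < b) (h : ConsequentAt v) :
    ConsequentAt (scaledPotential v b) := by
  obtain ⟨ρ₀, hρ₀, hρ⟩ := h
  exact ⟨ρ₀ / b ^ 3, by positivity, consequentBody_scaledPotential hb hρ⟩

/-- **Exact covariance**: `ConsequentAt (b⁻²v(·/b)) ↔ ConsequentAt v`. [folklore] -/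
theorem consequentAt_scaledPotential_iff {v : ℝ → ℝ≥0∞} {b : ℝ} (hb : 0 < b) :
    ConsequentAt (scaledPotential v b) ↔ ConsequentAt v := by
  refine ⟨fun h => ?_, consequentAt_scaledPotential hb⟩
  have := consequentAt_scaledPotential (inv_pos.2 hb) h
  rwa [scaledPotential_scaledPotential_inv hb] at this

/-- A threshold for `b⁻²v(·/b)` below `ρ₀` gives one for `v` below `ρ₀ b³` (undoing the scaling).
[folklore] -/
theorem consequentBody_of_scaledPotential {v : ℝ → ℝ≥0∞} {b ρ₀ : ℝ} (hb : 0 < b)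
    (h : ∀ ρ : ℝ, 0 < ρ → ρ < ρ₀ → ∃ c : ℝ, 0 < c ∧ ∀ᶠ N : ℕ in atTop,
      ∃ δ : ℝ≥0∞, 0 < δ ∧ ∀ Ψ : PeriodicTrialState N (sideLength ρ N),
        periodicEnergy (scaledPotential v b) Ψ ≤
            periodicGroundStateEnergy (scaledPotential v b) N (sideLength ρ N) + δ →
          ENNReal.ofReal (c * N) ≤ condensateOccupation N (sideLength ρ N) Ψ.ψ) :
    ∀ ρ : ℝ, 0 < ρ → ρ < ρ₀ * b ^ 3 → ∃ c : ℝ, 0 < c ∧ ∀ᶠ N : ℕ in atTop,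
      ∃ δ : ℝ≥0∞, 0 < δ ∧ ∀ Ψ : PeriodicTrialState N (sideLength ρ N),
        periodicEnergy v Ψ ≤ periodicGroundStateEnergy v N (sideLength ρ N) + δ →
          ENNReal.ofReal (c * N) ≤ condensateOccupation N (sideLength ρ N) Ψ.ψ := by
  have h' := consequentBody_scaledPotential (ρ₀ := ρ₀) (inv_pos.2 hb) h
  rw [scaledPotential_scaledPotential_inv hb, inv_pow, div_inv_eq_mul] at h'
  exact h'

/-- **The threshold of the hard-sphere gas scales exactly like `a⁻³`**: a threshold `ρ₀` for
`hardCorePotential 1` yields the threshold `ρ₀/a³` for `hardCorePotential a`, since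
`a⁻² · hardCorePotential 1 (·/a) = hardCorePotential a`. Companion of
`threshold_le_of_consequentAt_hardCorePotential` (part II). [folklore] -/
theorem scaledPotential_hardCorePotential_one {a : ℝ} (ha : 0 < a) :
    scaledPotential (hardCorePotential 1) a = hardCorePotential a := by
  funext r
  simp only [scaledPotential, hardCorePotential]
  by_cases hr : r < a
  · have : r / a < 1 := by rwa [div_lt_one ha]
    rw [if_pos this, if_pos hr, ENNReal.mul_top]
    simp
  · have : ¬ r / a < 1 := by rwa [div_lt_one ha]
    rw [if_neg this, if_neg hr, mul_zero]

/-- **`PeriodicBEC` reduces to unit range.** Torus BEC for every admissible potential is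
equivalent to torus BEC for every admissible potential vanishing beyond radius `1` (scale a
potential of range `R₀ > 1` down by `R₀`, conclude, scale back). [folklore] -/
theorem periodicBEC_iff_unitRange :
    BECPeriodicReduction.PeriodicBEC ↔
      ∀ v : ℝ → ℝ≥0∞, IsRepulsiveFiniteRange v → (∀ r, 1 < r → v r = 0) → ConsequentAt v := by
  rw [periodicBEC_iff]
  refine ⟨fun h v hv _ => h v hv, fun h v hv => ?_⟩
  obtain ⟨hmeas, R₀, hR₀⟩ := hv
  by_cases hR : R₀ ≤ 1
  · exact h v ⟨hmeas, R₀, hR₀⟩ fun r hr => hR₀ r (lt_of_le_of_lt hR hr)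
  · push Not at hR
    have hRpos : 0 < R₀ := one_pos.trans hR
    -- `w = R₀² v(R₀ ·)` has unit range and `v = R₀⁻² w(·/R₀)`
    have hw : IsRepulsiveFiniteRange (scaledPotential v R₀⁻¹) :=
      isRepulsiveFiniteRange_scaledPotential ⟨hmeas, R₀, hR₀⟩ (inv_pos.2 hRpos)
    have hw1 : ∀ r, 1 < r → scaledPotential v R₀⁻¹ r = 0 := by
      intro r hr
      have : R₀ < r * R₀ := by nlinarith
      simp only [scaledPotential, div_inv_eq_mul, hR₀ _ this, mul_zero]
    have := consequentAt_scaledPotential hRpos (h _ hw hw1)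
    have hvv : scaledPotential (scaledPotential v R₀⁻¹) R₀ = v := by
      have := scaledPotential_scaledPotential_inv (inv_pos.2 hRpos) v
      rwa [inv_inv] at this
    rwa [hvv] at this

/-- **The bridge reduces to unit range** likewise. [folklore] -/
theorem crux_iff_unitRange :
    LatticeToPeriodicBridge ↔
      (KineticLatticeBEC →
        ∀ v : ℝ → ℝ≥0∞, IsRepulsiveFiniteRange v → (∀ r, 1 < r → v r = 0) → ConsequentAt v) := by
  rw [crux_iff, periodicBEC_iff_unitRange]

end Summit.AtomisticToContinuum.BoseEinsteinCondensation.Theorems.LatticeToPeriodicBridge.Negative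

end
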